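import Literature.NumberTheory.LFunctions.RudnickSarnakNCellTransform
import HarnessLib

/-!
# Rudnick–Sarnak `n`-level correlations for `ζ`, XVI: the factors of a cell integral and the error terms

Sibling file of `Literature/NumberTheory/LFunctions/RudnickSarnak.lean` (toward
`Literature.NumberTheory.LFunctions.rudnick_sarnak_unrestricted` at every level). For a pattern
`(D, P, β)` the cell integral of `RudnickSarnakNMainTerm.lean` is the sum over the matchings `β`
of

  `J_β(T) = ∫_η Φ(ξ) Π_{j∈D} g₀(Lξ_j) 1_{cell}(ξ) Π_{p∈P} 𝒫_T(L|ξ_p|, L|ξ_{βp}|) dη`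
  (`RudnickSarnakN.Jbeta`, `RudnickSarnakN.cellMain_eq_sum_Jbeta`),

and by the prime number theorem (`RudnickSarnakNPrimePair.lean`) each pair factor is a main factor
`A_p = Lξ_{βp} K(L(ξ_p + ξ_{βp}))` plus an error `E_p`, `|E_p| ≤ C₀ 1[|L(ξ_p + ξ_{βp})| < 1/2]`
(Rudnick–Sarnak 1996, (3.66)–(3.68)); expanding, `J_β = Σ_{E' ⊆ P} J_{β,E'}`
(`RudnickSarnakN.Jbeta_eq_sum_JE`). In the variables of `RudnickSarnakNCellTransform.lean` every
term with `E' ≠ ∅` is `O(L^{1−|D|−|E'|})` (`RudnickSarnakN.norm_JE_le`: the pattern majorant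
integrates to `O(L^{−|U|})`, `|U| = |D| + |P| − 1`), i.e. negligible against the main term
`E' = ∅`, which is of order `L^{1−|D|}` (next file).

## References

* Z. Rudnick, P. Sarnak, *Zeros of principal `L`-functions and random matrix theory*, Duke Math.
  J. 81 (1996), 269–322, (3.66)–(3.73).
-/

noncomputable section

open Complex Filter Set MeasureTheory Finset
open scoped Real Topology

namespace Literature.NumberTheory.LFunctions

namespace RudnickSarnakN

variable {k : ℕ}

section Pattern

variable (D P : Finset (Fin (k + 1))) (β : ↥P ≃ ↥((Finset.univ \ D) \ P))

/-! ## The factors -/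

/-- The pair factor `𝒫_T(L|ξ_p|, L|ξ_{βp}|)`. [cite: RudnickSarnak1996, (3.65)] -/
def pairFac (T : ℝ) (ξ : Fin (k + 1) → ℝ) (p : Fin (k + 1)) : ℝ :=
  primePair T (Real.log T * |ξ p|) (Real.log T * |ξ (betaF D P β p)|)

/-- The main pair factor `A_p = L ξ_{βp} K(L(ξ_p + ξ_{βp}))`. [cite: RudnickSarnak1996, (3.68)] -/
def Afac (T : ℝ) (ξ : Fin (k + 1) → ℝ) (p : Fin (k + 1)) : ℝ :=
  Real.log T * ξ (betaF D P β p) * Kfun (Real.log T * (ξ p + ξ (betaF D P β p)))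

/-- The error pair factor `E_p = 𝒫 − A_p`. [cite: RudnickSarnak1996, (3.68)] -/
def Efac (T : ℝ) (ξ : Fin (k + 1) → ℝ) (p : Fin (k + 1)) : ℝ :=
  pairFac D P β T ξ p - Afac D P β T ξ p

/-- The cell indicator `1[Dᶜ⁺(ξ) = P]`. [folklore] -/
def cellInd (ξ : Fin (k + 1) → ℝ) : ℝ := by
  classical
  exact if posSide ξ (Finset.univ \ D) = P then 1 else 0

/-- The density factor `Π_{j∈D} g₀(L ξ_j)`. [folklore] -/
def densR (T : ℝ) (ξ : Fin (k + 1) → ℝ) : ℝ := ∏ j ∈ D, g0R (Real.log T * ξ j)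

/-- The `(β, E')` cell integral. [cite: RudnickSarnak1996, (3.69)] -/
def JE (Φ : (Fin (k + 1) → ℝ) → ℂ) (E' : Finset (Fin (k + 1))) (T : ℝ) : ℂ :=
  ∫ η : Fin k → ℝ, Φ (slicePt η) * ((densR D T (slicePt η) * cellInd D P (slicePt η) *
    ((∏ p ∈ E', Efac D P β T (slicePt η) p) * ∏ p ∈ P \ E', Afac D P β T (slicePt η) p) : ℝ) : ℂ)

/-- The `β` cell integral. [cite: RudnickSarnak1996, (3.65)] -/
def Jbeta (Φ : (Fin (k + 1) → ℝ) → ℂ) (T : ℝ) : ℂ :=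
  ∫ η : Fin k → ℝ, Φ (slicePt η) * ((densG T D η *
    (if posSide (slicePt η) (Finset.univ \ D) = P then
      ∏ p : P, primePair T (freq T (slicePt η) p) (freq T (slicePt η) (β p)) else 0) : ℝ) : ℂ)

variable {D P β}

/-! ## Elementary properties of the factors -/

/-- `densG = densR ∘ ξ` (`g₀` is even). [folklore] -/
theorem densG_eq_densR (T : ℝ) (η : Fin k → ℝ) : densG T D η = densR D T (slicePt η) := by
  unfold densG densR freq
  refine Finset.prod_congr rfl fun j _ ↦ ?_
  show g0R (Real.log T * |slicePt η j|) = g0R (Real.log T * slicePt η j)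
  rcases le_or_gt 0 (slicePt η j) with h | h
  · rw [abs_of_nonneg h]
  · rw [abs_of_neg h, mul_neg, g0R_neg]

/-- `0 ≤ densR ≤ (max ∫φ 1)ⁿ`. [folklore] -/
theorem densR_mem (T : ℝ) (ξ : Fin (k + 1) → ℝ) : 0 ≤ densR D T ξ ∧ densR D T ξ ≤ (max bumpMass 1) ^ (k + 1) := by
  unfold densR
  refine ⟨Finset.prod_nonneg fun j _ ↦ g0R_nonneg _, ?_⟩
  have hcard : D.card ≤ k + 1 := by have := D.card_le_univ; rwa [Fintype.card_fin] at this
  calc ∏ j ∈ D, g0R (Real.log T * ξ j) ≤ ∏ _j ∈ D, max bumpMass 1 :=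
        Finset.prod_le_prod (fun j _ ↦ g0R_nonneg _) fun j _ ↦ (g0R_le _).trans (le_max_left _ _)
    _ = (max bumpMass 1) ^ D.card := Finset.prod_const _
    _ ≤ (max bumpMass 1) ^ (k + 1) := pow_le_pow_right₀ (le_max_right _ _) hcard

/-- `cellInd ∈ {0, 1}`. [folklore] -/
theorem cellInd_mem (ξ : Fin (k + 1) → ℝ) : 0 ≤ cellInd D P ξ ∧ cellInd D P ξ ≤ 1 := by
  unfold cellInd; split_ifs <;> norm_num

/-- On the cell: `ξ_p ≤ 0 < ξ_{βp}` for `p ∈ P`. [folklore] -/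
theorem cell_sign {ξ : Fin (k + 1) → ℝ} (hcell : posSide ξ (Finset.univ \ D) = P) {p : Fin (k + 1)} (hp : p ∈ P) :
    ξ p ≤ 0 ∧ 0 < ξ (betaF D P β p) := by
  have h1 : p ∈ posSide ξ (Finset.univ \ D) := by rw [hcell]; exact hp
  unfold posSide at h1
  rw [Finset.mem_filter] at h1
  refine ⟨h1.2, ?_⟩
  have hq := betaF_mem D P β hp
  rw [Finset.mem_sdiff] at hq
  by_contra h
  push Not at h
  have h2 : betaF D P β p ∈ posSide ξ (Finset.univ \ D) := by
    unfold posSide; exact Finset.mem_filter.2 ⟨hq.1, h⟩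
  rw [hcell] at h2
  exact hq.2 h2

/-- **Support of the pair sum**: `𝒫_T(x, y) = 0` when `|x − y| ≥ 1/2`. [folklore] -/
theorem primePair_eq_zero_of_le {T x y : ℝ} (h : 1 / 2 ≤ |x - y|) : primePair T x y = 0 := by
  unfold primePair
  refine Finset.sum_eq_zero fun m _ ↦ ?_
  split_ifs with hm
  · by_contra hne
    have hx : coefR x m ≠ 0 := left_ne_zero_of_mul hne
    have hy : coefR y m ≠ 0 := right_ne_zero_of_mul hne
    have h1 := exp_lt_of_coefR_ne_zero hx
    have h2 := lt_exp_of_coefR_ne_zero hx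
    have h3 := exp_lt_of_coefR_ne_zero hy
    have h4 := lt_exp_of_coefR_ne_zero hy
    have h5 : x - 1 / 4 < y + 1 / 4 := Real.exp_lt_exp.1 (h1.trans h4)
    have h6 : y - 1 / 4 < x + 1 / 4 := Real.exp_lt_exp.1 (h3.trans h2)
    rcases abs_cases (x - y) with ⟨h7, _⟩ | ⟨h7, _⟩ <;> linarith
  · rfl

/-- `A_p = 0` when `|L(ξ_p + ξ_{βp})| ≥ 1/2`. [folklore] -/
theorem Afac_eq_zero_of_le {T : ℝ} {ξ : Fin (k + 1) → ℝ} {p : Fin (k + 1)}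
    (h : 1 / 2 ≤ |Real.log T * (ξ p + ξ (betaF D P β p))|) : Afac D P β T ξ p = 0 := by
  unfold Afac; rw [Kfun_eq_zero h, mul_zero]

/-- **The error factor on the cell** (Rudnick–Sarnak 1996, (3.68) via the PNT): for `T ≥ 3`, `ξ` in
the cell and the box, `|E_p(ξ)| ≤ C₀` and `E_p(ξ) = 0` unless `|L(ξ_p + ξ_{βp})| < 1/2`.
[cite: RudnickSarnak1996, (3.66)–(3.68)] -/
theorem abs_Efac_le {T : ℝ} (hT : 3 ≤ T) {ξ : Fin (k + 1) → ℝ} (hbox : ∀ j, |ξ j| ≤ 2)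
    (hcell : posSide ξ (Finset.univ \ D) = P) {p : Fin (k + 1)} (hp : p ∈ P) :
    |Efac D P β T ξ p| ≤ primePairConst * (if |Real.log T * (ξ p + ξ (betaF D P β p))| < 1 / 2 then 1 else 0) := by
  have hT1 : (1 : ℝ) ≤ T := by linarith
  have hL : 0 ≤ Real.log T := Real.log_nonneg hT1
  obtain ⟨hpx, hqx⟩ := cell_sign (β := β) hcell hp
  set L := Real.log T
  set q := betaF D P β p
  split_ifs with hlt
  · rw [mul_one]
    unfold Efac pairFac Afac
    have hy : L * |ξ q| ≤ 2 * Real.log T := by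
      rw [abs_of_pos hqx]; nlinarith [hbox q, abs_of_pos hqx]
    rw [primePair_eq_primePairFull hy, abs_of_nonpos hpx, abs_of_pos hqx]
    have h := abs_primePairFull_sub_le (L * -ξ p) (y := L * ξ q) (by positivity)
    have e : L * ξ q * Kfun (L * (ξ p + ξ q)) = L * ξ q * Kfun (L * -ξ p - L * ξ q) := by
      rw [show L * -ξ p - L * ξ q = -(L * (ξ p + ξ q)) by ring, Kfun_neg]
    rw [e]
    exact h
  · rw [mul_zero]
    push Not at hlt
    unfold Efac pairFac
    rw [Afac_eq_zero_of_le hlt, sub_zero, abs_of_nonpos hpx, abs_of_pos hqx, primePair_eq_zero_of_le, abs_zero]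
    rwa [show L * -ξ p - L * ξ q = -(L * (ξ p + ξ q)) by ring, abs_neg]

/-- **The main factor on the cell and the box**: `|A_p(ξ)| ≤ 2L (∫φ) κ(0) 1[|L(ξ_p + ξ_{βp})| < 1/2]`.
[folklore] -/
theorem abs_Afac_le {T : ℝ} (hT : 1 ≤ T) {ξ : Fin (k + 1) → ℝ} (hbox : ∀ j, |ξ j| ≤ 2) (p : Fin (k + 1)) :
    |Afac D P β T ξ p| ≤ 2 * Real.log T * (bumpMass * ker 0) *
      (if |Real.log T * (ξ p + ξ (betaF D P β p))| < 1 / 2 then 1 else 0) := by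
  have hL : 0 ≤ Real.log T := Real.log_nonneg hT
  split_ifs with hlt
  · rw [mul_one]
    unfold Afac
    rw [abs_mul, abs_mul, abs_of_nonneg hL, abs_of_nonneg (Kfun_nonneg _)]
    have h1 := hbox (betaF D P β p)
    have h2 := Kfun_le (Real.log T * (ξ p + ξ (betaF D P β p)))
    have h3 := Kfun_nonneg (Real.log T * (ξ p + ξ (betaF D P β p)))
    have := bumpMass_pos; have := ker_zero_pos
    calc Real.log T * |ξ (betaF D P β p)| * Kfun (Real.log T * (ξ p + ξ (betaF D P β p)))
        ≤ Real.log T * 2 * (bumpMass * ker 0) := mul_le_mul (mul_le_mul_of_nonneg_left h1 hL) h2 h3 (by positivity)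
      _ = 2 * Real.log T * (bumpMass * ker 0) := by ring
  · rw [mul_zero]
    push Not at hlt
    rw [Afac_eq_zero_of_le hlt, abs_zero]

/-! ## Continuity and measurability -/

/-- Continuity of `ξ ↦ A_p(ξ)`. [folklore] -/
theorem continuous_Afac (T : ℝ) (p : Fin (k + 1)) : Continuous fun ξ : Fin (k + 1) → ℝ ↦ Afac D P β T ξ p := by
  unfold Afac
  exact ((continuous_const.mul (continuous_apply _)).mul
    (continuous_Kfun.comp (continuous_const.mul ((continuous_apply _).add (continuous_apply _)))))

/-- Continuity of `ξ ↦ 𝒫_T(L|ξ_p|, L|ξ_{βp}|)`. [folklore] -/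
theorem continuous_pairFac (T : ℝ) (p : Fin (k + 1)) : Continuous fun ξ : Fin (k + 1) → ℝ ↦ pairFac D P β T ξ p := by
  unfold pairFac
  have h1 : Continuous fun ξ : Fin (k + 1) → ℝ ↦ Real.log T * |ξ p| := continuous_const.mul (continuous_apply p).abs
  have h2 : Continuous fun ξ : Fin (k + 1) → ℝ ↦ Real.log T * |ξ (betaF D P β p)| :=
    continuous_const.mul (continuous_apply _).abs
  exact (continuous_primePair T).comp₂ h1 h2

/-- Continuity of `ξ ↦ E_p(ξ)`. [folklore] -/
theorem continuous_Efac (T : ℝ) (p : Fin (k + 1)) : Continuous fun ξ : Fin (k + 1) → ℝ ↦ Efac D P β T ξ p :=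
  (continuous_pairFac T p).sub (continuous_Afac T p)

/-- Continuity of `densR`. [folklore] -/
theorem continuous_densR (T : ℝ) : Continuous fun ξ : Fin (k + 1) → ℝ ↦ densR D T ξ := by
  unfold densR
  exact continuous_finsetProd _ fun j _ ↦ contDiff_g0R.continuous.comp (continuous_const.mul (continuous_apply j))

/-- `η ↦ ξ(η)` is continuous. [folklore] -/
theorem continuous_slicePt' : Continuous fun η : Fin k → ℝ ↦ slicePt η :=
  continuous_pi fun j ↦ continuous_slicePt_apply j

/-- Measurability of the cell indicator along the slice. [folklore] -/
theorem measurable_cellInd : Measurable fun η : Fin k → ℝ ↦ cellInd D P (slicePt η) := by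
  classical
  unfold cellInd
  exact Measurable.ite (measurableSet_cell _ _) measurable_const measurable_const

/-- Measurability of the `(β, E')` integrand factor. [folklore] -/
theorem measurable_JE_factor (T : ℝ) (E' : Finset (Fin (k + 1))) :
    Measurable fun η : Fin k → ℝ ↦ densR D T (slicePt η) * cellInd D P (slicePt η) *
      ((∏ p ∈ E', Efac D P β T (slicePt η) p) * ∏ p ∈ P \ E', Afac D P β T (slicePt η) p) := by
  refine ((((continuous_densR T).comp continuous_slicePt').measurable.mul measurable_cellInd).mul ?_)
  exact (((continuous_finsetProd _ fun p _ ↦ continuous_Efac T p).mul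
    (continuous_finsetProd _ fun p _ ↦ continuous_Afac T p)).comp continuous_slicePt').measurable

/-! ## Integrability along the slice with box support -/

/-- The box indicator. [folklore] -/
def boxInd (ξ : Fin (k + 1) → ℝ) : ℝ := ∏ j, (if |ξ j| ≤ 2 then (1 : ℝ) else 0)

omit β in
/-- `boxInd ∈ {0,1}` and `boxInd = 1` on the box. [folklore] -/
theorem boxInd_mem (ξ : Fin (k + 1) → ℝ) : 0 ≤ boxInd ξ ∧ boxInd ξ ≤ 1 ∧ ((∀ j, |ξ j| ≤ 2) → boxInd ξ = 1) ∧
    ((¬ ∀ j, |ξ j| ≤ 2) → boxInd ξ = 0) := by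
  unfold boxInd
  refine ⟨Finset.prod_nonneg fun j _ ↦ by split_ifs <;> norm_num,
    Finset.prod_le_one (fun j _ ↦ by split_ifs <;> norm_num) fun j _ ↦ by split_ifs <;> norm_num, fun h ↦ ?_, fun h ↦ ?_⟩
  · exact Finset.prod_eq_one fun j _ ↦ if_pos (h j)
  · push Not at h
    obtain ⟨j, hj⟩ := h
    exact Finset.prod_eq_zero (Finset.mem_univ j) (if_neg (not_le.2 hj))

/-- **Integrability against a box-supported `Φ`**: if `F` is measurable along the slice and bounded on
the box, then `Φ(ξ) F(ξ)` is integrable along the slice. [folklore] -/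
theorem integrable_phi_mul_of_bdd_on_box {Φ : (Fin (k + 1) → ℝ) → ℂ}
    (hΦi : Integrable fun η : Fin k → ℝ ↦ Φ (slicePt η)) (hΦs : ∀ ξ, Φ ξ ≠ 0 → ∀ j, |ξ j| ≤ 2)
    {F : (Fin (k + 1) → ℝ) → ℝ} (hF : Measurable fun η : Fin k → ℝ ↦ F (slicePt η)) {B : ℝ}
    (hB : ∀ ξ, (∀ j, |ξ j| ≤ 2) → |F ξ| ≤ B) :
    Integrable fun η : Fin k → ℝ ↦ Φ (slicePt η) * ((F (slicePt η) : ℝ) : ℂ) := by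
  classical
  set G : (Fin k → ℝ) → ℝ := fun η ↦ boxInd (slicePt η) * F (slicePt η)
  have hGm : Measurable G := by
    refine Measurable.mul ?_ hF
    unfold boxInd
    refine Finset.measurable_prod _ fun j _ ↦ Measurable.ite ?_ measurable_const measurable_const
    exact measurableSet_le (continuous_slicePt_apply j).measurable.abs measurable_const
  have hGb : ∀ η, ‖((G η : ℝ) : ℂ)‖ ≤ max B 0 := fun η ↦ by
    rw [Complex.norm_real, Real.norm_eq_abs]
    simp only [G]
    by_cases hb : ∀ j, |slicePt η j| ≤ 2
    · rw [(boxInd_mem _).2.2.1 hb, one_mul]; exact (hB _ hb).trans (le_max_left _ _)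
    · rw [(boxInd_mem _).2.2.2 hb, zero_mul, abs_zero]; exact le_max_right _ _
  have h := hΦi.bdd_mul (c := max B 0) (Complex.measurable_ofReal.comp hGm).aestronglyMeasurable (Eventually.of_forall hGb)
  refine h.congr (Eventually.of_forall fun η ↦ ?_)
  simp only [Function.comp_apply, G]
  by_cases hΦ : Φ (slicePt η) = 0
  · rw [hΦ, mul_zero, zero_mul]
  · rw [(boxInd_mem _).2.2.1 (hΦs _ hΦ), one_mul, mul_comm]

/-- A uniform bound for the pair sum: `0 ≤ 𝒫_T(x,y) ≤ Σ_{m ≤ N_T} (∫φ)² Λ(m)²/m`. [folklore] -/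
theorem primePair_le_const (T x y : ℝ) :
    primePair T x y ≤ ∑ m ∈ Finset.Icc 1 (primeBound T), bumpMass ^ 2 * ((ArithmeticFunction.vonMangoldt m : ℝ) ^ 2 / m) := by
  unfold primePair
  refine Finset.sum_le_sum fun m hm ↦ ?_
  have hm1 : (0 : ℝ) < m := by rw [Finset.mem_Icc] at hm; exact_mod_cast hm.1
  have hb : coefR x m * coefR y m ≤ bumpMass ^ 2 * ((ArithmeticFunction.vonMangoldt m : ℝ) ^ 2 / m) := by
    have h1 := coefR_le x m
    have h2 := coefR_le y m
    calc coefR x m * coefR y m ≤ (bumpMass * (ArithmeticFunction.vonMangoldt m / Real.sqrt m)) *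
          (bumpMass * (ArithmeticFunction.vonMangoldt m / Real.sqrt m)) :=
          mul_le_mul h1 h2 (coefR_nonneg _ _) ((coefR_nonneg _ _).trans h1)
      _ = bumpMass ^ 2 * ((ArithmeticFunction.vonMangoldt m : ℝ) ^ 2 / m) := by
          rw [show bumpMass * ((ArithmeticFunction.vonMangoldt m : ℝ) / Real.sqrt m) *
            (bumpMass * ((ArithmeticFunction.vonMangoldt m : ℝ) / Real.sqrt m)) =
            bumpMass ^ 2 * ((ArithmeticFunction.vonMangoldt m : ℝ) ^ 2 / (Real.sqrt m * Real.sqrt m)) by ring,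
            Real.mul_self_sqrt hm1.le]
  split_ifs
  · exact hb
  · have := bumpMass_pos
    have : (0 : ℝ) ≤ ArithmeticFunction.vonMangoldt m := ArithmeticFunction.vonMangoldt_nonneg
    positivity

/-- Bounds on the box for the factors: `|𝒫| ≤ ppB`, `|A_p| ≤ 4L Kmax`, `|E_p| ≤ ppB + 4L Kmax`. [folklore] -/
theorem abs_factors_le_on_box {T : ℝ} (hT : 1 ≤ T) {ξ : Fin (k + 1) → ℝ} (hbox : ∀ j, |ξ j| ≤ 2) (p : Fin (k + 1)) :
    |Afac D P β T ξ p| ≤ 2 * Real.log T * (bumpMass * ker 0) ∧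
    |Efac D P β T ξ p| ≤ (∑ m ∈ Finset.Icc 1 (primeBound T), bumpMass ^ 2 * ((ArithmeticFunction.vonMangoldt m : ℝ) ^ 2 / m)) +
      2 * Real.log T * (bumpMass * ker 0) := by
  have hA : |Afac D P β T ξ p| ≤ 2 * Real.log T * (bumpMass * ker 0) := by
    refine (abs_Afac_le hT hbox p).trans ?_
    have hL : 0 ≤ Real.log T := Real.log_nonneg hT
    have := bumpMass_pos; have := ker_zero_pos
    split_ifs
    · rw [mul_one]
    · rw [mul_zero]; positivity
  refine ⟨hA, ?_⟩
  unfold Efac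
  refine (abs_sub _ _).trans (add_le_add ?_ hA)
  unfold pairFac
  rw [abs_of_nonneg (primePair_nonneg _ _ _)]
  exact primePair_le_const _ _ _

/-- Integrability of the `(β, E')` integrand. [folklore] -/
theorem integrable_JE_integrand {Φ : (Fin (k + 1) → ℝ) → ℂ}
    (hΦi : Integrable fun η : Fin k → ℝ ↦ Φ (slicePt η)) (hΦs : ∀ ξ, Φ ξ ≠ 0 → ∀ j, |ξ j| ≤ 2)
    {T : ℝ} (hT : 1 ≤ T) (E' : Finset (Fin (k + 1))) :
    Integrable fun η : Fin k → ℝ ↦ Φ (slicePt η) * ((densR D T (slicePt η) * cellInd D P (slicePt η) *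
      ((∏ p ∈ E', Efac D P β T (slicePt η) p) * ∏ p ∈ P \ E', Afac D P β T (slicePt η) p) : ℝ) : ℂ) := by
  set ppB : ℝ := ∑ m ∈ Finset.Icc 1 (primeBound T), bumpMass ^ 2 * ((ArithmeticFunction.vonMangoldt m : ℝ) ^ 2 / m)
  set KA : ℝ := 2 * Real.log T * (bumpMass * ker 0)
  refine integrable_phi_mul_of_bdd_on_box hΦi hΦs
    (F := fun ξ ↦ densR D T ξ * cellInd D P ξ * ((∏ p ∈ E', Efac D P β T ξ p) * ∏ p ∈ P \ E', Afac D P β T ξ p))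
    (measurable_JE_factor T E')
    (B := (max bumpMass 1) ^ (k + 1) * ((ppB + KA) ^ E'.card * KA ^ (P \ E').card)) fun ξ hbox ↦ ?_
  have hKA : 0 ≤ KA := by
    have := bumpMass_pos; have := ker_zero_pos; have := Real.log_nonneg hT; positivity
  have hppB : 0 ≤ ppB := Finset.sum_nonneg fun m _ ↦ by
    have := bumpMass_pos; have : (0:ℝ) ≤ ArithmeticFunction.vonMangoldt m := ArithmeticFunction.vonMangoldt_nonneg
    positivity
  rw [abs_mul, abs_mul]
  obtain ⟨hd0, hd1⟩ := densR_mem (D := D) T ξ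
  obtain ⟨hc0, hc1⟩ := cellInd_mem (D := D) (P := P) ξ
  rw [abs_of_nonneg hd0, abs_of_nonneg hc0, abs_mul, Finset.abs_prod, Finset.abs_prod]
  have hE : ∏ p ∈ E', |Efac D P β T ξ p| ≤ (ppB + KA) ^ E'.card := by
    rw [← Finset.prod_const]
    exact Finset.prod_le_prod (fun p _ ↦ abs_nonneg _) fun p _ ↦ (abs_factors_le_on_box hT hbox p).2
  have hA : ∏ p ∈ P \ E', |Afac D P β T ξ p| ≤ KA ^ (P \ E').card := by
    rw [← Finset.prod_const]
    exact Finset.prod_le_prod (fun p _ ↦ abs_nonneg _) fun p _ ↦ (abs_factors_le_on_box hT hbox p).1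
  calc densR D T ξ * cellInd D P ξ * ((∏ p ∈ E', |Efac D P β T ξ p|) * ∏ p ∈ P \ E', |Afac D P β T ξ p|)
      ≤ (max bumpMass 1) ^ (k + 1) * 1 * ((ppB + KA) ^ E'.card * KA ^ (P \ E').card) := by
        refine mul_le_mul (mul_le_mul hd1 hc1 hc0 (by positivity)) (mul_le_mul hE hA (Finset.prod_nonneg fun _ _ ↦ abs_nonneg _)
          (by positivity)) (by positivity) (by positivity)
    _ = _ := by rw [mul_one]

/-! ## The cell integral as a sum over `E' ⊆ P` -/

/-- **`J_β = Σ_{E' ⊆ P} J_{β,E'}`.** [cite: RudnickSarnak1996, (3.68)] -/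
theorem Jbeta_eq_sum_JE {Φ : (Fin (k + 1) → ℝ) → ℂ}
    (hΦi : Integrable fun η : Fin k → ℝ ↦ Φ (slicePt η)) (hΦs : ∀ ξ, Φ ξ ≠ 0 → ∀ j, |ξ j| ≤ 2)
    {T : ℝ} (hT : 1 ≤ T) :
    Jbeta D P β Φ T = ∑ E' ∈ P.powerset, JE D P β Φ E' T := by
  classical
  unfold Jbeta JE
  rw [← integral_finsetSum _ fun E' _ ↦ integrable_JE_integrand hΦi hΦs hT E']
  refine integral_congr_ae (ae_of_all _ fun η ↦ ?_)
  dsimp only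
  rw [← Finset.mul_sum]
  congr 1
  rw [← Complex.ofReal_sum]
  congr 1
  rw [densG_eq_densR]
  have hprod : ∏ p : P, primePair T (freq T (slicePt η) p) (freq T (slicePt η) (β p)) =
      ∏ p ∈ P, (Efac D P β T (slicePt η) p + Afac D P β T (slicePt η) p) := by
    rw [prod_subtype_P (β := β) (fun p q ↦ primePair T (freq T (slicePt η) p) (freq T (slicePt η) q))]
    refine Finset.prod_congr rfl fun p _ ↦ ?_
    unfold Efac pairFac freq
    ring
  rw [hprod, Finset.prod_add]
  unfold cellInd
  split_ifs with hc
  · rw [Finset.mul_sum]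
    refine Finset.sum_congr rfl fun E' _ ↦ ?_
    ring
  · simp

/-- **`cellMain = Σ_β J_β`.** [folklore] -/
theorem cellMain_eq_sum_Jbeta {Φ : (Fin (k + 1) → ℝ) → ℂ}
    (hΦi : Integrable fun η : Fin k → ℝ ↦ Φ (slicePt η)) (hΦs : ∀ ξ, Φ ξ ≠ 0 → ∀ j, |ξ j| ≤ 2) (T : ℝ) :
    cellMain Φ T D P = ∑ β' : (↥P ≃ ↥((Finset.univ \ D) \ P)), Jbeta D P β' Φ T := by
  classical
  unfold cellMain Jbeta
  have hint : ∀ β' : (↥P ≃ ↥((Finset.univ \ D) \ P)), Integrable fun η : Fin k → ℝ ↦ Φ (slicePt η) * ((densG T D η *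
      (if posSide (slicePt η) (Finset.univ \ D) = P then
        ∏ p : P, primePair T (freq T (slicePt η) p) (freq T (slicePt η) (β' p)) else 0) : ℝ) : ℂ) := by
    intro β'
    have h := integrable_JE_integrand (β := β') hΦi hΦs (le_refl (1 : ℝ)) ∅
    -- use `J_β = Σ J_{β,E'}` pointwise? simpler: bounded on the box directly
    refine integrable_phi_mul_of_bdd_on_box hΦi hΦs (F := fun ξ ↦ (∏ j ∈ D, g0R (Real.log T * |ξ j|)) *
      (if posSide ξ (Finset.univ \ D) = P then ∏ p : P, primePair T (Real.log T * |ξ p|) (Real.log T * |ξ (β' p)|) else 0))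
      ?_ (B := (max bumpMass 1) ^ (k + 1) *
        (max 1 (∑ m ∈ Finset.Icc 1 (primeBound T), bumpMass ^ 2 * ((ArithmeticFunction.vonMangoldt m : ℝ) ^ 2 / m))) ^ (k + 1))
      fun ξ hbox ↦ ?_
    · refine Measurable.mul ?_ (Measurable.ite (measurableSet_cell _ _) ?_ measurable_const)
      · exact (continuous_finsetProd _ fun j _ ↦ contDiff_g0R.continuous.comp
          (continuous_const.mul (continuous_slicePt_apply j).abs)).measurable
      · refine (continuous_finsetProd _ fun p _ ↦ ?_).measurable
        exact (continuous_primePair T).comp₂ (continuous_const.mul (continuous_slicePt_apply _).abs)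
          (continuous_const.mul (continuous_slicePt_apply _).abs)
    · set ppB := ∑ m ∈ Finset.Icc 1 (primeBound T), bumpMass ^ 2 * ((ArithmeticFunction.vonMangoldt m : ℝ) ^ 2 / m)
      rw [abs_mul]
      have h1 : |∏ j ∈ D, g0R (Real.log T * |ξ j|)| ≤ (max bumpMass 1) ^ (k + 1) := by
        rw [Finset.abs_prod]
        have hcard : D.card ≤ k + 1 := by have := D.card_le_univ; rwa [Fintype.card_fin] at this
        calc ∏ j ∈ D, |g0R (Real.log T * |ξ j|)| ≤ ∏ _j ∈ D, max bumpMass 1 :=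
              Finset.prod_le_prod (fun j _ ↦ abs_nonneg _) fun j _ ↦ by
                rw [abs_of_nonneg (g0R_nonneg _)]; exact (g0R_le _).trans (le_max_left _ _)
          _ = (max bumpMass 1) ^ D.card := Finset.prod_const _
          _ ≤ _ := pow_le_pow_right₀ (le_max_right _ _) hcard
      have h2 : |(if posSide ξ (Finset.univ \ D) = P then ∏ p : P, primePair T (Real.log T * |ξ p|) (Real.log T * |ξ (β' p)|) else 0)| ≤
          (max 1 ppB) ^ (k + 1) := by
        split_ifs
        · rw [Finset.abs_prod]
          calc ∏ p : P, |primePair T (Real.log T * |ξ p|) (Real.log T * |ξ (β' p)|)| ≤ ∏ _p : P, max 1 ppB :=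
                Finset.prod_le_prod (fun p _ ↦ abs_nonneg _) fun p _ ↦ by
                  rw [abs_of_nonneg (primePair_nonneg _ _ _)]; exact (primePair_le_const _ _ _).trans (le_max_right _ _)
            _ = (max 1 ppB) ^ Fintype.card P := by rw [Finset.prod_const, Finset.card_univ]
            _ ≤ _ := pow_le_pow_right₀ (le_max_left _ _) (by
                rw [Fintype.card_coe]; have := P.card_le_univ; rwa [Fintype.card_fin] at this)
        · rw [abs_zero]; positivity
      exact mul_le_mul h1 h2 (abs_nonneg _) (by positivity)
  rw [← integral_finsetSum _ fun β' _ ↦ hint β']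
  refine integral_congr_ae (ae_of_all _ fun η ↦ ?_)
  dsimp only
  rw [← Finset.mul_sum]
  congr 1
  rw [← Complex.ofReal_sum]
  congr 1
  unfold cellPair pairMain
  split_ifs
  · rw [Finset.mul_sum]
  · simp

/-! ## The pattern majorant and the size of the error terms -/

variable (D P β) in
/-- The nearness indicator of a pair: `1[|L(ξ_p + ξ_{βp})| < 1/2]`. [folklore] -/
def nearInd (T : ℝ) (ξ : Fin (k + 1) → ℝ) (p : Fin (k + 1)) : ℝ :=
  if |Real.log T * (ξ p + ξ (betaF D P β p))| < 1 / 2 then 1 else 0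

/-- `nearInd ∈ {0,1}`. [folklore] -/
theorem nearInd_mem (T : ℝ) (ξ : Fin (k + 1) → ℝ) (p : Fin (k + 1)) : 0 ≤ nearInd D P β T ξ p ∧ nearInd D P β T ξ p ≤ 1 := by
  unfold nearInd; split_ifs <;> norm_num

variable (D P β) in
/-- **The pattern majorant** `M₀(ξ) = 1_{box}(ξ) Π_{j∈D} g₀(Lξ_j) Π_{p∈P} 1[|L(ξ_p + ξ_{βp})| < 1/2]`.
[folklore] -/
def M0 (T : ℝ) (ξ : Fin (k + 1) → ℝ) : ℝ := boxInd ξ * densR D T ξ * ∏ p ∈ P, nearInd D P β T ξ p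

/-- `M₀ ≥ 0`. [folklore] -/
theorem M0_nonneg (T : ℝ) (ξ : Fin (k + 1) → ℝ) : 0 ≤ M0 D P β T ξ :=
  mul_nonneg (mul_nonneg (boxInd_mem ξ).1 (densR_mem T ξ).1) (Finset.prod_nonneg fun p _ ↦ (nearInd_mem T ξ p).1)

/-- **Pointwise domination of the `(β, E')` integrand by the majorant**: for `T ≥ 3`, `E' ⊆ P`,
`‖Φ(ξ) dens cellInd Π_{E'} E Π_{P∖E'} A‖ ≤ M_Φ C₀^{|E'|} (2L ∫φ κ(0))^{|P∖E'|} M₀(ξ)`.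
[cite: RudnickSarnak1996, (3.68)] -/
theorem norm_JE_integrand_le {Φ : (Fin (k + 1) → ℝ) → ℂ} {MΦ : ℝ} (hΦb : ∀ ξ, ‖Φ ξ‖ ≤ MΦ)
    (hΦs : ∀ ξ, Φ ξ ≠ 0 → ∀ j, |ξ j| ≤ 2) {T : ℝ} (hT : 3 ≤ T) {E' : Finset (Fin (k + 1))} (hE' : E' ⊆ P)
    (ξ : Fin (k + 1) → ℝ) :
    ‖Φ ξ * ((densR D T ξ * cellInd D P ξ * ((∏ p ∈ E', Efac D P β T ξ p) * ∏ p ∈ P \ E', Afac D P β T ξ p) : ℝ) : ℂ)‖ ≤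
      MΦ * primePairConst ^ E'.card * (2 * Real.log T * (bumpMass * ker 0)) ^ (P \ E').card * M0 D P β T ξ := by
  classical
  have hT1 : (1 : ℝ) ≤ T := by linarith
  have hM0 : 0 ≤ MΦ := (norm_nonneg _).trans (hΦb 0)
  have hC0 := primePairConst_nonneg
  have hKm : 0 ≤ 2 * Real.log T * (bumpMass * ker 0) := by
    have := bumpMass_pos; have := ker_zero_pos; have := Real.log_nonneg hT1; positivity
  have hRHS : 0 ≤ MΦ * primePairConst ^ E'.card * (2 * Real.log T * (bumpMass * ker 0)) ^ (P \ E').card * M0 D P β T ξ := by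
    have := M0_nonneg (D := D) (P := P) (β := β) T ξ; positivity
  by_cases hΦ0 : Φ ξ = 0
  · rw [hΦ0, zero_mul, norm_zero]; exact hRHS
  have hbox := hΦs ξ hΦ0
  by_cases hcell : posSide ξ (Finset.univ \ D) = P
  · have hci : cellInd D P ξ = 1 := by unfold cellInd; rw [if_pos hcell]
    have hbi : boxInd ξ = 1 := (boxInd_mem ξ).2.2.1 hbox
    rw [norm_mul, Complex.norm_real, Real.norm_eq_abs, hci, mul_one, abs_mul, abs_of_nonneg (densR_mem T ξ).1,
      abs_mul, Finset.abs_prod, Finset.abs_prod]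
    have hE : ∏ p ∈ E', |Efac D P β T ξ p| ≤ primePairConst ^ E'.card * ∏ p ∈ E', nearInd D P β T ξ p := by
      calc ∏ p ∈ E', |Efac D P β T ξ p| ≤ ∏ p ∈ E', (primePairConst * nearInd D P β T ξ p) :=
            Finset.prod_le_prod (fun p _ ↦ abs_nonneg _) fun p hp ↦ abs_Efac_le hT hbox hcell (hE' hp)
        _ = _ := by rw [Finset.prod_mul_distrib, Finset.prod_const]
    have hA : ∏ p ∈ P \ E', |Afac D P β T ξ p| ≤ (2 * Real.log T * (bumpMass * ker 0)) ^ (P \ E').card *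
        ∏ p ∈ P \ E', nearInd D P β T ξ p := by
      calc ∏ p ∈ P \ E', |Afac D P β T ξ p| ≤ ∏ p ∈ P \ E', (2 * Real.log T * (bumpMass * ker 0) * nearInd D P β T ξ p) :=
            Finset.prod_le_prod (fun p _ ↦ abs_nonneg _) fun p _ ↦ abs_Afac_le hT1 hbox p
        _ = _ := by rw [Finset.prod_mul_distrib, Finset.prod_const]
    have hprodnear : (∏ p ∈ E', nearInd D P β T ξ p) * ∏ p ∈ P \ E', nearInd D P β T ξ p = ∏ p ∈ P, nearInd D P β T ξ p := by
      rw [mul_comm, Finset.prod_sdiff hE']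
    have hn0 : 0 ≤ ∏ p ∈ E', nearInd D P β T ξ p := Finset.prod_nonneg fun p _ ↦ (nearInd_mem T ξ p).1
    have hEA0 : 0 ≤ (∏ p ∈ E', |Efac D P β T ξ p|) * ∏ p ∈ P \ E', |Afac D P β T ξ p| :=
      mul_nonneg (Finset.prod_nonneg fun _ _ ↦ abs_nonneg _) (Finset.prod_nonneg fun _ _ ↦ abs_nonneg _)
    calc ‖Φ ξ‖ * (densR D T ξ * ((∏ p ∈ E', |Efac D P β T ξ p|) * ∏ p ∈ P \ E', |Afac D P β T ξ p|))
        ≤ MΦ * (densR D T ξ * ((primePairConst ^ E'.card * ∏ p ∈ E', nearInd D P β T ξ p) *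
            ((2 * Real.log T * (bumpMass * ker 0)) ^ (P \ E').card * ∏ p ∈ P \ E', nearInd D P β T ξ p))) := by
          refine mul_le_mul (hΦb ξ) (mul_le_mul_of_nonneg_left (mul_le_mul hE hA (Finset.prod_nonneg fun _ _ ↦ abs_nonneg _)
            (mul_nonneg (pow_nonneg hC0 _) hn0)) (densR_mem T ξ).1) (mul_nonneg (densR_mem T ξ).1 hEA0) hM0
      _ = MΦ * primePairConst ^ E'.card * (2 * Real.log T * (bumpMass * ker 0)) ^ (P \ E').card * M0 D P β T ξ := by
          unfold M0; rw [hbi, one_mul, ← hprodnear]; ring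
  · have hci : cellInd D P ξ = 0 := by unfold cellInd; rw [if_neg hcell]
    rw [hci, mul_zero, zero_mul, Complex.ofReal_zero, mul_zero, norm_zero]; exact hRHS

variable (D P β) in
/-- The one-dimensional functions of the product bound: `g₀` on `Dη`, `1[|x| < 1/2]` on `A`,
`1[|x| ≤ 2]` elsewhere. [folklore] -/
def uFun (i : Fin k) (x : ℝ) : ℝ :=
  if i ∈ Didx D then g0R x else if i ∈ Aidx D P β then (if |x| < 1 / 2 then 1 else 0) else (if |x| ≤ 2 then 1 else 0)

/-- `uFun ≥ 0`. [folklore] -/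
theorem uFun_nonneg (i : Fin k) (x : ℝ) : 0 ≤ uFun D P β i x := by
  unfold uFun; split_ifs
  · exact g0R_nonneg _
  all_goals norm_num

/-- The indicator integrals. [folklore] -/
theorem integral_ite_abs_lt : ∫ x : ℝ, (if |x| < 1 / 2 then (1 : ℝ) else 0) = 1 := by
  have e : (fun x : ℝ ↦ if |x| < 1 / 2 then (1 : ℝ) else 0) = Set.indicator (Set.Ioo (-(1 / 2)) (1 / 2)) 1 := by
    funext x
    by_cases h : |x| < 1 / 2
    · rw [if_pos h, Set.indicator_of_mem (Set.mem_Ioo.2 (abs_lt.1 h)), Pi.one_apply]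
    · rw [if_neg h, Set.indicator_of_notMem (fun hm ↦ h (abs_lt.2 (Set.mem_Ioo.1 hm)))]
  rw [e, integral_indicator_one measurableSet_Ioo, Real.volume_real_Ioo]; norm_num

/-- The indicator integrals. [folklore] -/
theorem integral_ite_abs_le : ∫ x : ℝ, (if |x| ≤ 2 then (1 : ℝ) else 0) = 4 := by
  have e : (fun x : ℝ ↦ if |x| ≤ 2 then (1 : ℝ) else 0) = Set.indicator (Set.Icc (-2) 2) 1 := by
    funext x
    by_cases h : |x| ≤ 2
    · rw [if_pos h, Set.indicator_of_mem (Set.mem_Icc.2 (abs_le.1 h)), Pi.one_apply]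
    · rw [if_neg h, Set.indicator_of_notMem (fun hm ↦ h (abs_le.2 (Set.mem_Icc.1 hm)))]
  rw [e, integral_indicator_one measurableSet_Icc, Real.volume_real_Icc]; norm_num

/-- Integrability of the indicators. [folklore] -/
theorem integrable_ite_abs_lt : Integrable fun x : ℝ ↦ (if |x| < 1 / 2 then (1 : ℝ) else 0) := by
  have e : (fun x : ℝ ↦ if |x| < 1 / 2 then (1 : ℝ) else 0) = Set.indicator (Set.Ioo (-(1 / 2)) (1 / 2)) 1 := by
    funext x
    by_cases h : |x| < 1 / 2
    · rw [if_pos h, Set.indicator_of_mem (Set.mem_Ioo.2 (abs_lt.1 h)), Pi.one_apply]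
    · rw [if_neg h, Set.indicator_of_notMem (fun hm ↦ h (abs_lt.2 (Set.mem_Ioo.1 hm)))]
  rw [e, integrable_indicator_iff measurableSet_Ioo]
  exact integrableOn_const (by rw [Real.volume_Ioo]; exact ENNReal.ofReal_ne_top)

/-- Integrability of the indicators. [folklore] -/
theorem integrable_ite_abs_le : Integrable fun x : ℝ ↦ (if |x| ≤ 2 then (1 : ℝ) else 0) := by
  have e : (fun x : ℝ ↦ if |x| ≤ 2 then (1 : ℝ) else 0) = Set.indicator (Set.Icc (-2) 2) 1 := by
    funext x
    by_cases h : |x| ≤ 2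
    · rw [if_pos h, Set.indicator_of_mem (Set.mem_Icc.2 (abs_le.1 h)), Pi.one_apply]
    · rw [if_neg h, Set.indicator_of_notMem (fun hm ↦ h (abs_le.2 (Set.mem_Icc.1 hm)))]
  rw [e, integrable_indicator_iff measurableSet_Icc]
  exact integrableOn_const (by rw [Real.volume_Icc]; exact ENNReal.ofReal_ne_top)

/-- `uFun i` is integrable with `∫ uFun i ≤ max κ(0) 4`. [folklore] -/
theorem uFun_integral (i : Fin k) : Integrable (uFun D P β i) ∧ ∫ x, uFun D P β i x ≤ max (ker 0) 4 := by
  unfold uFun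
  split_ifs
  · exact ⟨integrable_g0R, by rw [integral_g0R]; exact le_max_left _ _⟩
  · exact ⟨integrable_ite_abs_lt, by rw [integral_ite_abs_lt]; exact le_trans (by norm_num) (le_max_right _ _)⟩
  · exact ⟨integrable_ite_abs_le, by rw [integral_ite_abs_le]; exact le_max_right _ _⟩

omit β in
/-- `D ∖ {0}` is the image of `Dη` under `i ↦ i + 1`. [folklore] -/
theorem erase_zero_eq_image : D.erase 0 = (Didx D).image Fin.succ := by
  ext j
  rw [Finset.mem_erase, Finset.mem_image]
  constructor
  · rintro ⟨hj0, hj⟩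
    refine ⟨j.pred hj0, ?_, Fin.succ_pred _ _⟩
    rw [Didx, Finset.mem_filter, Fin.succ_pred]; exact ⟨Finset.mem_univ _, hj⟩
  · rintro ⟨i, hi, rfl⟩
    rw [Didx, Finset.mem_filter] at hi
    exact ⟨Fin.succ_ne_zero _, hi.2⟩

/-- **The majorant in the new variables is dominated by a product**: for `L > 0` and `P ⊆ Dᶜ`,
`M₀(ξ_T(η)) ≤ (max ∫φ 1) Π_i u_i(η_i)`. [folklore] -/
theorem M0_xiT_le (hP : P ⊆ Finset.univ \ D) {T : ℝ} (hT : 3 ≤ T) (η : Fin k → ℝ) :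
    M0 D P β T (xiT D P β (Real.log T) η) ≤ (max bumpMass 1) * ∏ i, uFun D P β i (η i) := by
  classical
  set L := Real.log T
  have hL : 0 < L := by have := one_le_log hT; simp only [L]; linarith
  set ξ := xiT D P β L η with hξ
  -- (i) the box factor
  have hbox : boxInd ξ ≤ ∏ i ∈ Finset.univ \ Uidx D P β, (if |η i| ≤ 2 then (1 : ℝ) else 0) := by
    unfold boxInd
    set b : Fin (k + 1) → ℝ := fun j ↦ if |ξ j| ≤ 2 then (1 : ℝ) else 0
    have hb0 : ∀ j, 0 ≤ b j := fun j ↦ by simp only [b]; split_ifs <;> norm_num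
    have hb1 : ∀ j, b j ≤ 1 := fun j ↦ by simp only [b]; split_ifs <;> norm_num
    set S' := (Finset.univ \ Uidx D P β).image Fin.succ
    have h1 : ∏ j, b j ≤ ∏ j ∈ S', b j := by
      rw [← Finset.prod_mul_prod_compl S' b]
      exact mul_le_of_le_one_right (Finset.prod_nonneg fun j _ ↦ hb0 j) (Finset.prod_le_one (fun j _ ↦ hb0 j) fun j _ ↦ hb1 j)
    refine h1.trans (le_of_eq ?_)
    rw [Finset.prod_image fun i _ j _ h ↦ Fin.succ_injective _ h]
    refine Finset.prod_congr rfl fun i hi ↦ ?_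
    have hiA : i ∉ Aidx D P β := fun h ↦ (Finset.mem_sdiff.1 hi).2 (Finset.mem_union_right _ h)
    have hiU : i ∉ Uidx D P β := (Finset.mem_sdiff.1 hi).2
    simp only [b, hξ]
    rw [xiT_succ_of_not_mem_A η hiA]
    unfold cvec
    rw [if_neg hiU, one_mul]
  -- (ii) the density factor
  have hdens : densR D T ξ ≤ (max bumpMass 1) * ∏ i ∈ Didx D, g0R (η i) := by
    unfold densR
    have hrest : ∏ j ∈ D.erase 0, g0R (Real.log T * ξ j) = ∏ i ∈ Didx D, g0R (η i) := by
      rw [erase_zero_eq_image, Finset.prod_image fun i _ j _ h ↦ Fin.succ_injective _ h]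
      refine Finset.prod_congr rfl fun i hi ↦ ?_
      simp only [hξ]
      rw [xiT_succ_of_mem_D hP η hi, ← mul_assoc, show Real.log T * L⁻¹ = 1 from mul_inv_cancel₀ hL.ne', one_mul]
    by_cases h0 : (0 : Fin (k + 1)) ∈ D
    · rw [← Finset.mul_prod_erase D _ h0, hrest]
      exact mul_le_mul_of_nonneg_right ((g0R_le _).trans (le_max_left _ _)) (Finset.prod_nonneg fun _ _ ↦ g0R_nonneg _)
    · rw [Finset.erase_eq_of_notMem h0] at hrest
      rw [hrest]
      exact le_mul_of_one_le_left (Finset.prod_nonneg fun _ _ ↦ g0R_nonneg _) (le_max_right _ _)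
  -- (iii) the nearness factor
  have hnear : ∏ p ∈ P, nearInd D P β T ξ p ≤ ∏ a ∈ Aidx D P β, (if |η a| < 1 / 2 then (1 : ℝ) else 0) := by
    rw [prod_P_split (β := β)]
    have hA : ∏ a ∈ Aidx D P β, nearInd D P β T ξ a.succ = ∏ a ∈ Aidx D P β, (if |η a| < 1 / 2 then (1 : ℝ) else 0) := by
      refine Finset.prod_congr rfl fun a ha ↦ ?_
      unfold nearInd
      simp only [hξ]
      rw [← prt_succ D P β ha, xiT_succ_of_mem_A η ha, xiT_succ_prt η ha,
        show Real.log T * (-(L⁻¹ * η a) - η (prt D P β a) + η (prt D P β a)) = -(Real.log T * L⁻¹) * η a by ring,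
        mul_inv_cancel₀ hL.ne', neg_one_mul, abs_neg]
    rw [hA]
    refine mul_le_of_le_one_right (Finset.prod_nonneg fun a _ ↦ by split_ifs <;> norm_num) ?_
    exact Finset.prod_le_one (fun p _ ↦ (nearInd_mem T ξ p).1) fun p _ ↦ (nearInd_mem T ξ p).2
  -- (iv) assemble
  have hu : ∏ i, uFun D P β i (η i) = (∏ i ∈ Didx D, g0R (η i)) *
      ((∏ a ∈ Aidx D P β, (if |η a| < 1 / 2 then (1 : ℝ) else 0)) * ∏ i ∈ Finset.univ \ Uidx D P β, (if |η i| ≤ 2 then (1 : ℝ) else 0)) := by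
    unfold uFun
    rw [Finset.prod_ite, Finset.filter_mem_eq_inter, Finset.univ_inter, Finset.prod_ite]
    congr 2
    · refine Finset.prod_congr ?_ fun _ _ ↦ rfl
      ext i
      simp only [Finset.mem_filter, Finset.mem_univ, true_and]
      constructor
      · exact fun h ↦ h.2
      · exact fun h ↦ ⟨Finset.disjoint_right.1 (disjoint_Didx_Aidx (β := β) hP) h, h⟩
    · refine Finset.prod_congr ?_ fun _ _ ↦ rfl
      ext i
      simp only [Finset.mem_filter, Finset.mem_univ, true_and, Finset.mem_sdiff, Uidx, Finset.mem_union, not_or]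
  rw [hu]
  unfold M0
  have h1 : 0 ≤ ∏ i ∈ Didx D, g0R (η i) := Finset.prod_nonneg fun _ _ ↦ g0R_nonneg _
  have h2 : 0 ≤ ∏ a ∈ Aidx D P β, (if |η a| < 1 / 2 then (1 : ℝ) else 0) := Finset.prod_nonneg fun _ _ ↦ by split_ifs <;> norm_num
  have h3 : 0 ≤ ∏ i ∈ Finset.univ \ Uidx D P β, (if |η i| ≤ 2 then (1 : ℝ) else 0) :=
    Finset.prod_nonneg fun _ _ ↦ by split_ifs <;> norm_num
  calc boxInd ξ * densR D T ξ * ∏ p ∈ P, nearInd D P β T ξ p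
      ≤ (∏ i ∈ Finset.univ \ Uidx D P β, (if |η i| ≤ 2 then (1 : ℝ) else 0)) *
          ((max bumpMass 1) * ∏ i ∈ Didx D, g0R (η i)) * ∏ a ∈ Aidx D P β, (if |η a| < 1 / 2 then (1 : ℝ) else 0) :=
        mul_le_mul (mul_le_mul hbox hdens (densR_mem T ξ).1 h3) hnear (Finset.prod_nonneg fun p _ ↦ (nearInd_mem T ξ p).1)
          (by positivity)
    _ = (max bumpMass 1) * ((∏ i ∈ Didx D, g0R (η i)) *
          ((∏ a ∈ Aidx D P β, (if |η a| < 1 / 2 then (1 : ℝ) else 0)) * ∏ i ∈ Finset.univ \ Uidx D P β, (if |η i| ≤ 2 then (1 : ℝ) else 0))) := by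
        ring

/-- **The integral of the majorant**: `∫ M₀(ξ(η)) dη ≤ L^{−|U|} (max ∫φ 1) (max κ(0) 4)ᵏ` (`T ≥ 3`). [folklore] -/
theorem integral_M0_le (hP : P ⊆ Finset.univ \ D) {T : ℝ} (hT : 3 ≤ T) :
    ∫ η : Fin k → ℝ, M0 D P β T (slicePt η) ≤
      (Real.log T ^ (Uidx D P β).card)⁻¹ * ((max bumpMass 1) * (max (ker 0) 4) ^ k) := by
  set L := Real.log T
  have hL : 0 < L := by have := one_le_log hT; simp only [L]; linarith
  rw [integral_slicePt_eq_integral_xiT (D := D) (P := P) (β := β) hL (fun ξ ↦ M0 D P β T ξ), smul_eq_mul]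
  refine mul_le_mul_of_nonneg_left ?_ (by positivity)
  have hint : Integrable fun η : Fin k → ℝ ↦ (max bumpMass 1) * ∏ i, uFun D P β i (η i) := by
    refine Integrable.const_mul ?_ _
    have := Integrable.fintype_prod (f := fun i ↦ uFun D P β i) (μ := fun _ ↦ (volume : Measure ℝ)) fun i ↦ (uFun_integral i).1
    simpa [volume_pi] using this
  calc ∫ η : Fin k → ℝ, M0 D P β T (xiT D P β L η) ≤ ∫ η : Fin k → ℝ, (max bumpMass 1) * ∏ i, uFun D P β i (η i) :=
        integral_mono_of_nonneg (Eventually.of_forall fun η ↦ M0_nonneg T _) hint (Eventually.of_forall fun η ↦ M0_xiT_le hP hT η)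
    _ = (max bumpMass 1) * ∏ i, ∫ x, uFun D P β i x := by
        rw [integral_const_mul, integral_fintype_prod_volume_eq_prod]
    _ ≤ (max bumpMass 1) * (max (ker 0) 4) ^ k := by
        refine mul_le_mul_of_nonneg_left ?_ (by positivity)
        rw [show (max (ker 0) 4) ^ k = ∏ _i : Fin k, max (ker 0) 4 by rw [Finset.prod_const, Finset.card_univ, Fintype.card_fin]]
        exact Finset.prod_le_prod (fun i _ ↦ integral_nonneg fun x ↦ uFun_nonneg i x) fun i _ ↦ (uFun_integral i).2

/-- Measurability of `M₀` along the slice. [folklore] -/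
theorem measurable_M0_slicePt (T : ℝ) : Measurable fun η : Fin k → ℝ ↦ M0 D P β T (slicePt η) := by
  classical
  unfold M0 boxInd nearInd
  refine Measurable.mul (Measurable.mul ?_ ((continuous_densR T).comp continuous_slicePt').measurable) ?_
  · refine Finset.measurable_prod _ fun j _ ↦ Measurable.ite ?_ measurable_const measurable_const
    exact measurableSet_le (continuous_slicePt_apply j).measurable.abs measurable_const
  · refine Finset.measurable_prod _ fun p _ ↦ Measurable.ite ?_ measurable_const measurable_const
    exact measurableSet_lt (Continuous.measurable (by
      exact (continuous_const.mul ((continuous_slicePt_apply _).add (continuous_slicePt_apply _))).abs)) measurable_const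

/-- Integrability of `M₀` along the slice (bounded, supported in the box). [folklore] -/
theorem integrable_M0_slicePt (T : ℝ) : Integrable fun η : Fin k → ℝ ↦ M0 D P β T (slicePt η) := by
  classical
  set Bx : Set (Fin k → ℝ) := Set.Icc (fun _ ↦ (-2 : ℝ)) (fun _ ↦ 2)
  have hBx : volume Bx < ⊤ := by
    simp only [Bx]
    rw [Real.volume_Icc_pi]
    exact ENNReal.prod_lt_top fun i _ ↦ ENNReal.ofReal_lt_top
  have hg : Integrable (fun η : Fin k → ℝ ↦ Bx.indicator (fun _ ↦ (max bumpMass 1) ^ (k + 1)) η) :=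
    (integrable_indicator_iff measurableSet_Icc).2 (integrableOn_const hBx.ne)
  refine hg.mono' (measurable_M0_slicePt T).aestronglyMeasurable (Eventually.of_forall fun η ↦ ?_)
  rw [Real.norm_eq_abs, abs_of_nonneg (M0_nonneg T _)]
  rw [Set.indicator_apply]
  split_ifs with hη
  · unfold M0
    calc boxInd (slicePt η) * densR D T (slicePt η) * ∏ p ∈ P, nearInd D P β T (slicePt η) p
        ≤ 1 * (max bumpMass 1) ^ (k + 1) * 1 := by
          refine mul_le_mul (mul_le_mul (boxInd_mem _).2.1 (densR_mem T _).2 (densR_mem T _).1 zero_le_one) ?_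
            (Finset.prod_nonneg fun p _ ↦ (nearInd_mem T _ p).1) (by positivity)
          exact Finset.prod_le_one (fun p _ ↦ (nearInd_mem T _ p).1) fun p _ ↦ (nearInd_mem T _ p).2
      _ = (max bumpMass 1) ^ (k + 1) := by ring
  · -- outside the box `boxInd = 0`
    have hnot : ¬ ∀ j, |slicePt η j| ≤ 2 := by
      intro h
      apply hη
      simp only [Bx, Set.mem_Icc]
      constructor <;> intro i
      · have := h i.succ; unfold slicePt at this; rw [Fin.cons_succ] at this; exact (abs_le.1 this).1
      · have := h i.succ; unfold slicePt at this; rw [Fin.cons_succ] at this; exact (abs_le.1 this).2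
    unfold M0
    rw [(boxInd_mem _).2.2.2 hnot, zero_mul, zero_mul]

/-- **The size of the `(β, E')` cell integral**: for `T ≥ 3` and `E' ⊆ P`,
`‖J_{β,E'}(T)‖ ≤ M_Φ C₀^{|E'|} (2L ∫φ κ(0))^{|P∖E'|} L^{−|U|} (max ∫φ 1)(max κ(0) 4)ᵏ`.
[cite: RudnickSarnak1996, (3.68)–(3.73)] -/
theorem norm_JE_le (hP : P ⊆ Finset.univ \ D) {Φ : (Fin (k + 1) → ℝ) → ℂ} {MΦ : ℝ} (hΦb : ∀ ξ, ‖Φ ξ‖ ≤ MΦ)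
    (hΦs : ∀ ξ, Φ ξ ≠ 0 → ∀ j, |ξ j| ≤ 2) {T : ℝ} (hT : 3 ≤ T) {E' : Finset (Fin (k + 1))} (hE' : E' ⊆ P) :
    ‖JE D P β Φ E' T‖ ≤ MΦ * primePairConst ^ E'.card * (2 * Real.log T * (bumpMass * ker 0)) ^ (P \ E').card *
      ((Real.log T ^ (Uidx D P β).card)⁻¹ * ((max bumpMass 1) * (max (ker 0) 4) ^ k)) := by
  have hT1 : (1 : ℝ) ≤ T := by linarith
  set C1 : ℝ := MΦ * primePairConst ^ E'.card * (2 * Real.log T * (bumpMass * ker 0)) ^ (P \ E').card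
  have hM0 : 0 ≤ MΦ := (norm_nonneg _).trans (hΦb 0)
  have hC1 : 0 ≤ C1 := by
    have := primePairConst_nonneg; have := bumpMass_pos; have := ker_zero_pos; have := Real.log_nonneg hT1; positivity
  unfold JE
  calc ‖∫ η : Fin k → ℝ, Φ (slicePt η) * ((densR D T (slicePt η) * cellInd D P (slicePt η) *
        ((∏ p ∈ E', Efac D P β T (slicePt η) p) * ∏ p ∈ P \ E', Afac D P β T (slicePt η) p) : ℝ) : ℂ)‖
      ≤ ∫ η : Fin k → ℝ, C1 * M0 D P β T (slicePt η) :=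
        norm_integral_le_of_norm_le ((integrable_M0_slicePt T).const_mul C1)
          (Eventually.of_forall fun η ↦ norm_JE_integrand_le hΦb hΦs hT hE' _)
    _ = C1 * ∫ η : Fin k → ℝ, M0 D P β T (slicePt η) := integral_const_mul _ _
    _ ≤ C1 * ((Real.log T ^ (Uidx D P β).card)⁻¹ * ((max bumpMass 1) * (max (ker 0) 4) ^ k)) :=
        mul_le_mul_of_nonneg_left (integral_M0_le hP hT) hC1

/-- The error constant. [folklore] -/
def errConst (k : ℕ) : ℝ :=
  (max primePairConst 1) ^ (k + 1) * (max (2 * (bumpMass * ker 0)) 1) ^ (k + 1) * ((max bumpMass 1) * (max (ker 0) 4) ^ k)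

/-- `errConst ≥ 0`. [folklore] -/
theorem errConst_nonneg (k : ℕ) : 0 ≤ errConst k := by unfold errConst; positivity

/-- **The error terms in powers of `L`**: for `T ≥ 3`, a matching `β`, and `E' ⊆ P`,
`‖J_{β,E'}(T)‖ L^{|D| + |E'|} ≤ C_err(n) M_Φ L`; so `L^{|D|−1} J_{β,E'} = O(L^{−|E'|})`.
[cite: RudnickSarnak1996, (3.68)–(3.73)] -/
theorem norm_JE_mul_pow_le (hP : P ⊆ Finset.univ \ D) {Φ : (Fin (k + 1) → ℝ) → ℂ} {MΦ : ℝ} (hΦb : ∀ ξ, ‖Φ ξ‖ ≤ MΦ)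
    (hΦs : ∀ ξ, Φ ξ ≠ 0 → ∀ j, |ξ j| ≤ 2) {T : ℝ} (hT : 3 ≤ T) {E' : Finset (Fin (k + 1))} (hE' : E' ⊆ P) :
    ‖JE D P β Φ E' T‖ * Real.log T ^ (D.card + E'.card) ≤ errConst k * MΦ * Real.log T := by
  have hL := one_le_log hT
  have hL0 : 0 < Real.log T := by linarith
  have hM0 : 0 ≤ MΦ := (norm_nonneg _).trans (hΦb 0)
  have hC0 := primePairConst_nonneg
  have hbm := bumpMass_pos
  have hk0 := ker_zero_pos
  set L := Real.log T
  set e := E'.card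
  set u := (Uidx D P β).card
  have hcardPE : (P \ E').card + e = P.card := by simp only [e]; rw [Finset.card_sdiff_of_subset hE']; have := Finset.card_le_card hE'; omega
  have hU : u + 1 = D.card + P.card := card_Uidx (β := β) hP
  have hr : P.card ≤ k + 1 := by have := P.card_le_univ; rwa [Fintype.card_fin] at this
  have he : e ≤ k + 1 := (Finset.card_le_card hE').trans hr
  have h1 := norm_JE_le (β := β) hP hΦb hΦs hT hE'
  -- the `L`-powers
  have hpow : (2 * L * (bumpMass * ker 0)) ^ (P \ E').card * ((L ^ u)⁻¹) * L ^ (D.card + e) =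
      (2 * (bumpMass * ker 0)) ^ (P \ E').card * L := by
    rw [show 2 * L * (bumpMass * ker 0) = L * (2 * (bumpMass * ker 0)) by ring, mul_pow]
    have e1 : L ^ (P \ E').card * L ^ (D.card + e) = L ^ u * L := by
      rw [← pow_add, ← pow_succ]; congr 1; omega
    calc L ^ (P \ E').card * (2 * (bumpMass * ker 0)) ^ (P \ E').card * (L ^ u)⁻¹ * L ^ (D.card + e)
        = (2 * (bumpMass * ker 0)) ^ (P \ E').card * ((L ^ (P \ E').card * L ^ (D.card + e)) * (L ^ u)⁻¹) := by ring
      _ = (2 * (bumpMass * ker 0)) ^ (P \ E').card * L := by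
          rw [e1]; field_simp
  -- the constants
  have hc1 : primePairConst ^ e ≤ (max primePairConst 1) ^ (k + 1) :=
    (pow_le_pow_left₀ hC0 (le_max_left _ _) e).trans (pow_le_pow_right₀ (le_max_right _ _) he)
  have hc2 : (2 * (bumpMass * ker 0)) ^ (P \ E').card ≤ (max (2 * (bumpMass * ker 0)) 1) ^ (k + 1) := by
    have h0 : 0 ≤ 2 * (bumpMass * ker 0) := by have := bumpMass_pos; have := ker_zero_pos; positivity
    exact (pow_le_pow_left₀ h0 (le_max_left _ _) _).trans (pow_le_pow_right₀ (le_max_right _ _) (by omega))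
  calc ‖JE D P β Φ E' T‖ * L ^ (D.card + e)
      ≤ (MΦ * primePairConst ^ e * (2 * L * (bumpMass * ker 0)) ^ (P \ E').card *
          ((L ^ u)⁻¹ * ((max bumpMass 1) * (max (ker 0) 4) ^ k))) * L ^ (D.card + e) :=
        mul_le_mul_of_nonneg_right h1 (by positivity)
    _ = MΦ * primePairConst ^ e * ((max bumpMass 1) * (max (ker 0) 4) ^ k) *
          ((2 * L * (bumpMass * ker 0)) ^ (P \ E').card * ((L ^ u)⁻¹) * L ^ (D.card + e)) := by ring
    _ = MΦ * primePairConst ^ e * ((max bumpMass 1) * (max (ker 0) 4) ^ k) * ((2 * (bumpMass * ker 0)) ^ (P \ E').card * L) := by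
        rw [hpow]
    _ ≤ MΦ * (max primePairConst 1) ^ (k + 1) * ((max bumpMass 1) * (max (ker 0) 4) ^ k) *
          ((max (2 * (bumpMass * ker 0)) 1) ^ (k + 1) * L) := by
        refine mul_le_mul (mul_le_mul_of_nonneg_right (mul_le_mul_of_nonneg_left hc1 hM0) (by positivity))
          (mul_le_mul_of_nonneg_right hc2 hL0.le) (by positivity) (by positivity)
    _ = errConst k * MΦ * L := by unfold errConst; ring

end Pattern

end RudnickSarnakN

end Literature.NumberTheory.LFunctions

end
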